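import Literature.Analysis.FluidPDE.PassiveScalarDiagGalerkinBounds
import HarnessLib

/-!
# The Fourier–Galerkin energy argument for weak passive scalars with constant diagonal
# diffusion, IV: uniform dissipation bound, monotone convergence, vanishing remainder

Analysis/FluidPDE proof-support file (everything proved): the limit steps behind the energy
equality `PassiveScalarDiagEnergyEquality` for `Torus.IsWeakScalarTransportDiagForcedOn T a κ u s θ₀ θ`
(`κ > 0`, `aᵢ > 0`, `θ₀ ∈ L²`, `u ∈ L^∞`, `∫₀ᵀ‖s‖_{L²} < ∞`).

* `ae_galerkin_energy_eq_remainder` — the truncated identity in remainder form: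
  `‖P_Nθ(t)‖² = ‖P_Nθ₀‖² + 2∫₀ᵗ∫(θ - P_Nθ)⟪u,∇P_Nθ⟫ - 2κ∫₀ᵗ‖∇P_Nθ‖²_a + 2∫₀ᵗ∫ s P_Nθ` a.e.;
* **first pass** (`exists_integral_galerkin_diss_le`): Young's inequality
  `2C_u√e√G ≤ κ‖∇P_Nθ‖²_a + (C_u²/κm)∫(θ-P_Nθ)²` absorbs the remainder, whence a bound
  `∫₀ᵀ ‖∇P_Nθ‖²_a ≤ K` uniform in `N` — the `L²_t H¹_x` estimate of Bonicatto–Ciampa–Crippa 2024,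
  proof of Thm. 3.3, at the Galerkin level;
* **monotone convergence** (`lintegral_eScalarGradNormSqDiag_eq_iSup`): the ball partial sums
  increase to `‖∇θ‖²_a = Torus.eScalarGradNormSqDiag a θ`, so
  `∫⁻₀ᵗ ‖∇θ‖²_a = ⨆_N ofReal ∫₀ᵗ ‖∇P_Nθ‖²_a`; hence `∫⁻₀ᵀ ‖∇θ‖²_a < ⊤`
  (`lintegral_eScalarGradNormSqDiag_lt_top`: parabolicity, BCC 2024 Thm. 3.3);
* **second pass** (`tendsto_integral_galerkin_remainder`): Cauchy–Schwarz in space and time,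
  `|∫₀ᵗ∫(θ - P_Nθ)⟪u,∇P_Nθ⟫| ≤ (C_u/√m) √(∫₀ᵀ∫(θ-P_Nθ)²) √K → 0`.

## References

* P. Bonicatto, G. Ciampa, G. Crippa, J. Evol. Equ. 24 (2024), Paper No. 1 (arXiv:2306.15529),
  Thm. 3.3 and its proof ((3.1)–(3.4)). [`BonicattoCiampaCrippa2023`]
* J. C. Robinson, J. L. Rodrigo, W. Sadowski, *The three-dimensional Navier–Stokes equations*
  (CUP 2016), §4.2. [`RobinsonRodrigoSadowski2016`]
* L. Grafakos, *Classical Fourier Analysis*, 3rd ed. (2014), Prop. 3.2.7 (3). [`Grafakos2014`]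
-/
noncomputable section

open _root_.MeasureTheory _root_.Set _root_.Filter _root_.Function _root_.TopologicalSpace
open scoped ENNReal NNReal InnerProductSpace ContDiff Topology
open Literature.Analysis.FunctionSpaces.Torus Literature.Analysis.FunctionSpaces UnitAddTorus

namespace Literature.Analysis.FluidPDE

variable {d : Type*} [Fintype d] [DecidableEq d]

/-! ## Two real-analysis helpers -/

/-- **Cauchy–Schwarz for square roots**: `∫ √f √g ≤ √(∫ f) √(∫ g)` for nonnegative integrable
`f, g`. [folklore] -/
private theorem integral_sqrt_mul_sqrt_le_of_nonneg {α : Type*} [MeasurableSpace α] {μ : Measure α} {f g : α → ℝ}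
    (hf : Integrable f μ) (hg : Integrable g μ) (hf0 : 0 ≤ᵐ[μ] f) (hg0 : 0 ≤ᵐ[μ] g) :
    ∫ x, Real.sqrt (f x) * Real.sqrt (g x) ∂μ ≤ Real.sqrt (∫ x, f x ∂μ) * Real.sqrt (∫ x, g x ∂μ) := by
  have hmem : ∀ {φ : α → ℝ}, Integrable φ μ → 0 ≤ᵐ[μ] φ →
      MemLp (fun x => Real.sqrt (φ x)) (ENNReal.ofReal 2) μ := by
    intro φ hφ hφ0
    rw [show ENNReal.ofReal 2 = 2 by simp]
    refine (memLp_two_iff_integrable_sq (Real.continuous_sqrt.comp_aestronglyMeasurable hφ.1)).2 ?_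
    refine hφ.congr ?_
    filter_upwards [hφ0] with x hx
    rw [Real.sq_sqrt hx]
  have h := integral_mul_le_Lp_mul_Lq_of_nonneg Real.HolderConjugate.two_two
    (Eventually.of_forall fun x => Real.sqrt_nonneg (f x)) (Eventually.of_forall fun x => Real.sqrt_nonneg (g x))
    (hmem hf hf0) (hmem hg hg0)
  have e : ∀ {φ : α → ℝ}, 0 ≤ᵐ[μ] φ →
      (∫ x, Real.sqrt (φ x) ^ (2 : ℝ) ∂μ) ^ (1 / (2 : ℝ)) = Real.sqrt (∫ x, φ x ∂μ) := by
    intro φ hφ0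
    rw [Real.sqrt_eq_rpow]
    congr 1
    refine integral_congr_ae ?_
    filter_upwards [hφ0] with x hx
    rw [Real.rpow_two, Real.sq_sqrt hx]
  rwa [e hf0, e hg0] at h

/-- **Young's inequality behind the first pass**: for `0 < κ`, `0 < m` and reals `x, y` with
`m y² ≤ D`, `2 Cᵤ x y ≤ κ D + (Cᵤ²/(κ m)) x²`. [folklore] -/
private theorem two_mul_mul_le_of_mul_sq_le {κ m Cu x y D : ℝ} (hκ : 0 < κ) (hm : 0 < m) (hyD : m * y ^ 2 ≤ D) :
    2 * (Cu * (x * y)) ≤ κ * D + Cu ^ 2 / (κ * m) * x ^ 2 := by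
  have hκm : 0 < κ * m := mul_pos hκ hm
  have h1 : 2 * (Cu * (x * y)) ≤ κ * m * y ^ 2 + Cu ^ 2 / (κ * m) * x ^ 2 := by
    have key : κ * m * y ^ 2 + Cu ^ 2 / (κ * m) * x ^ 2 - 2 * (Cu * (x * y)) =
        (κ * m * y - Cu * x) ^ 2 / (κ * m) := by
      field_simp
      ring
    nlinarith [key, div_nonneg (sq_nonneg (κ * m * y - Cu * x)) hκm.le]
  have h2 : κ * m * y ^ 2 ≤ κ * D := by
    rw [mul_assoc]
    exact mul_le_mul_of_nonneg_left hyD hκ.le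
  linarith

namespace Torus

omit [DecidableEq d] in
/-- Positive coefficients on a finite index type are bounded below by a positive constant. [folklore] -/
private theorem exists_pos_forall_le_of_forall_pos {a : d → ℝ} (ha : ∀ i, 0 < a i) : ∃ m : ℝ, 0 < m ∧ ∀ i, m ≤ a i := by
  classical
  rcases isEmpty_or_nonempty d with hd | hd
  · exact ⟨1, one_pos, fun i => (IsEmpty.false i).elim⟩
  · obtain ⟨i₀, -, hi₀⟩ := Finset.exists_min_image Finset.univ a Finset.univ_nonempty
    exact ⟨a i₀, ha i₀, fun i => hi₀ i (Finset.mem_univ _)⟩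

namespace IsWeakScalarTransportDiagForcedOn

variable {T κ : ℝ} {a : d → ℝ} {u : ℝ → UnitAddTorus d → EuclideanSpace ℝ d} {s : ℝ → UnitAddTorus d → ℝ}
  {θ₀ : UnitAddTorus d → ℝ} {θ : ℝ → UnitAddTorus d → ℝ}

/-! ## The Galerkin identity in remainder form -/

/-- **The Galerkin energy identity in remainder form** (bounded drift): for a.e. `t ∈ (0,T)` and
every `N`,
`∑_{|k|≤N} |θ̂(t)(k)|² = ∑_{|k|≤N} |θ̂₀(k)|² + 2∫_{(0,t]} ∫(θ - P_Nθ)⟪u, ∇P_Nθ⟫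
   - 2κ ∫_{(0,t]} 4π² ∑ Q_a(k)|θ̂(k)|² + 2∫_{(0,t]} ∫ s P_N θ`.
[cite: RobinsonRodrigoSadowski2016, §4.2 (Galerkin energy estimate)] -/
theorem ae_galerkin_energy_eq_remainder (h : IsWeakScalarTransportDiagForcedOn T a κ u s θ₀ θ)
    (hθ₀ : Integrable θ₀ volume) (hu : MemLp (stLift u) ⊤ (volume.restrict (Ioo 0 T ×ˢ univ))) :
    ∀ᵐ t ∂(volume.restrict (Ioo 0 T)), ∀ N : ℕ,
      ∑ k ∈ freqBall N, ‖mFourierCoeff (fun x => (θ t x : ℂ)) k‖ ^ 2 =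
        ∑ k ∈ freqBall N, ‖mFourierCoeff (fun x => (θ₀ x : ℂ)) k‖ ^ 2 +
        2 * (∫ τ in Ioc 0 t, ∫ x, (θ τ x - scalarTruncate N (θ τ) x) *
          ⟪u τ x, gradient (scalarTruncate N (θ τ)) x⟫_ℝ) -
        2 * κ * (∫ τ in Ioc 0 t, 4 * Real.pi ^ 2 * ∑ k ∈ freqBall N,
          Torus.diagSymbol a k * ‖mFourierCoeff (fun x => (θ τ x : ℂ)) k‖ ^ 2) +
        2 * ∫ τ in Ioc 0 t, ∫ x, s τ x * scalarTruncate N (θ τ) x := by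
  have hid := ae_all_iff.2 fun N => h.ae_galerkin_energy_eq hθ₀ N
  have hrem : ∀ᵐ τ ∂(volume : Measure ℝ), τ ∈ Ioo 0 T → ∀ N : ℕ,
      ∫ x, θ τ x * ⟪u τ x, gradient (scalarTruncate N (θ τ)) x⟫_ℝ =
        ∫ x, (θ τ x - scalarTruncate N (θ τ) x) * ⟪u τ x, gradient (scalarTruncate N (θ τ)) x⟫_ℝ :=
    (ae_restrict_iff' measurableSet_Ioo).1 (ae_all_iff.2 fun N => h.ae_galerkin_transport_eq_remainder hu N)
  filter_upwards [hid, ae_restrict_mem measurableSet_Ioo] with t ht htT N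
  have hsub : Ioc 0 t ⊆ Ioo 0 T := Ioc_subset_Ioo_right htT.2
  have hR := (h.integrableOn_galerkin_transport N).mono_set hsub
  have hD : IntegrableOn (fun τ => κ * (4 * Real.pi ^ 2 * ∑ k ∈ freqBall N,
      Torus.diagSymbol a k * ‖mFourierCoeff (fun x => (θ τ x : ℂ)) k‖ ^ 2)) (Ioc 0 t) volume :=
    ((h.integrableOn_galerkin_diss N).mono_set hsub).const_mul κ
  have hS := (h.integrableOn_galerkin_source N).mono_set hsub
  have hRD : IntegrableOn (fun τ => (∫ x, θ τ x * ⟪u τ x, gradient (scalarTruncate N (θ τ)) x⟫_ℝ) -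
      κ * (4 * Real.pi ^ 2 * ∑ k ∈ freqBall N,
        Torus.diagSymbol a k * ‖mFourierCoeff (fun x => (θ τ x : ℂ)) k‖ ^ 2)) (Ioc 0 t) volume := hR.sub hD
  rw [ht N, integral_add hRD hS, integral_sub hR hD, integral_const_mul,
    setIntegral_congr_ae measurableSet_Ioc (hrem.mono fun τ hτ hτI => hτ (hsub hτI) N)]
  ring

/-! ## First pass: a uniform bound on the truncated dissipation -/

/-- **Uniform bound on the integrated truncated `A`-dissipation** (the first pass of the energy
argument: Young's inequality absorbs the transport remainder into half of the dissipation):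
there is `K` with `∫_{(0,T)} 4π² ∑_{|k|≤N} Q_a(k) |θ̂(τ)(k)|² dτ ≤ K` for every `N` — the
`L²_t H¹_x` bound of Bonicatto–Ciampa–Crippa 2024, Thm. 3.3 (proof), at the Galerkin level.
[cite: BonicattoCiampaCrippa2023, Thm. 3.3 (proof: uniform L²H¹ bound)] -/
theorem exists_integral_galerkin_diss_le (h : IsWeakScalarTransportDiagForcedOn T a κ u s θ₀ θ)
    (hκ : 0 < κ) (ha : ∀ i, 0 < a i) (hθ₀ : MemLp θ₀ 2 volume)
    (hu : MemLp (stLift u) ⊤ (volume.restrict (Ioo 0 T ×ˢ univ)))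
    (hs : ∫⁻ t in Ioo 0 T, (∫⁻ x, ‖s t x‖ₑ ^ 2) ^ (1 / 2 : ℝ) < ⊤) :
    ∃ K : ℝ, 0 ≤ K ∧ ∀ N : ℕ, ∫ τ in Ioo 0 T, 4 * Real.pi ^ 2 * ∑ k ∈ freqBall N,
      Torus.diagSymbol a k * ‖mFourierCoeff (fun x => (θ τ x : ℂ)) k‖ ^ 2 ≤ K := by
  obtain ⟨m, hm, hma⟩ := exists_pos_forall_le_of_forall_pos ha
  obtain ⟨Cu, hCu0, hR⟩ := h.exists_ae_abs_galerkin_remainder_le hu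
  obtain ⟨C, hC0, hC⟩ := h.exists_ae_integral_sq_le
  have hθ₀i : Integrable θ₀ volume := hθ₀.integrable one_le_two
  set Eint : ℝ := ∫ τ in Ioo 0 T, ∫ x, θ τ x ^ 2 with hEint
  set Sint : ℝ := ∫ τ in Ioo 0 T, Real.sqrt (∫ x, s τ x ^ 2) * Real.sqrt C with hSint
  have hEint0 : 0 ≤ Eint := setIntegral_nonneg measurableSet_Ioo fun τ _ => integral_nonneg fun x => sq_nonneg _
  have hSint0 : 0 ≤ Sint := setIntegral_nonneg measurableSet_Ioo fun τ _ => by positivity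
  have hE₀0 : 0 ≤ ∫ x, θ₀ x ^ 2 := integral_nonneg fun x => sq_nonneg _
  set K : ℝ := ((∫ x, θ₀ x ^ 2) + Cu ^ 2 / (κ * m) * Eint + 2 * Sint) / κ with hK
  have hK0 : 0 ≤ K := by positivity
  refine ⟨K, hK0, fun N => ?_⟩
  rcases le_or_gt T 0 with hT | hT
  · rw [Ioo_eq_empty_of_le hT, Measure.restrict_empty, integral_zero_measure]
    exact hK0
  refine setIntegral_Ioo_le_of_ae_setIntegral_Ioc_le hT (h.integrableOn_galerkin_diss N) ?_
  -- the pointwise Young bound on the remainder, for a.e. `τ ∈ (0,T)`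
  have hRpt : ∀ᵐ τ ∂(volume.restrict (Ioo 0 T)),
      |∫ x, (θ τ x - scalarTruncate N (θ τ) x) * ⟪u τ x, gradient (scalarTruncate N (θ τ)) x⟫_ℝ| ≤
        (κ * (4 * Real.pi ^ 2 * ∑ k ∈ freqBall N,
            Torus.diagSymbol a k * ‖mFourierCoeff (fun x => (θ τ x : ℂ)) k‖ ^ 2) +
          Cu ^ 2 / (κ * m) * ∫ x, (θ τ x - scalarTruncate N (θ τ) x) ^ 2) / 2 := by
    filter_upwards [hR N] with τ hτ
    have hG0 : 0 ≤ ∫ x, ‖gradient (scalarTruncate N (θ τ)) x‖ ^ 2 := integral_nonneg fun x => sq_nonneg _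
    have he0 : 0 ≤ ∫ x, (θ τ x - scalarTruncate N (θ τ) x) ^ 2 := integral_nonneg fun x => sq_nonneg _
    have hyD : m * Real.sqrt (∫ x, ‖gradient (scalarTruncate N (θ τ)) x‖ ^ 2) ^ 2 ≤
        4 * Real.pi ^ 2 * ∑ k ∈ freqBall N,
          Torus.diagSymbol a k * ‖mFourierCoeff (fun x => (θ τ x : ℂ)) k‖ ^ 2 := by
      rw [Real.sq_sqrt hG0]
      exact mul_integral_norm_sq_gradient_scalarTruncate_le hma N (θ τ)
    have h2 := two_mul_mul_le_of_mul_sq_le (Cu := Cu) (x := Real.sqrt (∫ x, (θ τ x - scalarTruncate N (θ τ) x) ^ 2))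
      hκ hm hyD
    rw [Real.sq_sqrt he0] at h2
    linarith
  filter_upwards [h.ae_galerkin_energy_eq_remainder hθ₀i hu, ae_restrict_mem measurableSet_Ioo] with t ht htT
  have hsub : Ioc 0 t ⊆ Ioo 0 T := Ioc_subset_Ioo_right htT.2
  specialize ht N
  -- the integrals over `(0,t]`
  have hDi := (h.integrableOn_galerkin_diss N).mono_set hsub
  have hRi := (h.integrableOn_galerkin_remainder hu N).mono_set hsub
  have hSi := (h.integrableOn_galerkin_source N).mono_set hsub
  have hei := (h.integrableOn_galerkin_tail N).mono_set hsub
  have hsq := h.integrableOn_integral_sq.mono_set hsub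
  have hnsT : IntegrableOn (fun τ => Real.sqrt (∫ x, s τ x ^ 2) * Real.sqrt C) (Ioo 0 T) volume :=
    (h.integrableOn_sqrt_integral_sq_source hs).mul_const (Real.sqrt C)
  have hns := hnsT.mono_set hsub
  -- (b1) the datum
  have hb1 : ∑ k ∈ freqBall N, ‖mFourierCoeff (fun x => (θ₀ x : ℂ)) k‖ ^ 2 ≤ ∫ x, θ₀ x ^ 2 :=
    sum_sq_norm_mFourierCoeff_le_integral_sq hθ₀ N
  have hb2 : 0 ≤ ∑ k ∈ freqBall N, ‖mFourierCoeff (fun x => (θ t x : ℂ)) k‖ ^ 2 :=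
    Finset.sum_nonneg fun k _ => sq_nonneg _
  -- (b3) the remainder
  have hb3 : |∫ τ in Ioc 0 t, ∫ x, (θ τ x - scalarTruncate N (θ τ) x) *
        ⟪u τ x, gradient (scalarTruncate N (θ τ)) x⟫_ℝ| ≤
      (κ * (∫ τ in Ioc 0 t, 4 * Real.pi ^ 2 * ∑ k ∈ freqBall N,
          Torus.diagSymbol a k * ‖mFourierCoeff (fun x => (θ τ x : ℂ)) k‖ ^ 2) +
        Cu ^ 2 / (κ * m) * ∫ τ in Ioc 0 t, ∫ x, (θ τ x - scalarTruncate N (θ τ) x) ^ 2) / 2 := by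
    rw [← integral_const_mul, ← integral_const_mul, ← integral_add (hDi.const_mul κ) (hei.const_mul _),
      ← integral_div]
    refine (abs_integral_le_integral_abs).trans (integral_mono_ae hRi.abs ?_ ?_)
    · exact ((hDi.const_mul κ).add (hei.const_mul _)).div_const _
    · exact ae_restrict_of_ae_restrict_of_subset hsub hRpt
  -- (b3') the tail integral
  have hb3' : ∫ τ in Ioc 0 t, ∫ x, (θ τ x - scalarTruncate N (θ τ) x) ^ 2 ≤ Eint := by
    calc ∫ τ in Ioc 0 t, ∫ x, (θ τ x - scalarTruncate N (θ τ) x) ^ 2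
        ≤ ∫ τ in Ioc 0 t, ∫ x, θ τ x ^ 2 :=
          integral_mono_ae hei hsq (ae_restrict_of_ae_restrict_of_subset hsub
            (h.ae_galerkin_tail.mono fun τ hτ => hτ.2.1 N))
      _ ≤ Eint := setIntegral_mono_set h.integrableOn_integral_sq
          (Eventually.of_forall fun τ => integral_nonneg fun x => sq_nonneg _) hsub.eventuallyLE
  -- (b4) the source
  have hb4 : |∫ τ in Ioc 0 t, ∫ x, s τ x * scalarTruncate N (θ τ) x| ≤ Sint := by
    calc |∫ τ in Ioc 0 t, ∫ x, s τ x * scalarTruncate N (θ τ) x|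
        ≤ ∫ τ in Ioc 0 t, Real.sqrt (∫ x, s τ x ^ 2) * Real.sqrt C := by
          refine (abs_integral_le_integral_abs).trans (integral_mono_ae hSi.abs hns ?_)
          refine ae_restrict_of_ae_restrict_of_subset hsub ?_
          filter_upwards [h.ae_abs_galerkin_source_le hs, hC] with τ hτ hτC
          exact (hτ N).1.trans (mul_le_mul_of_nonneg_left (Real.sqrt_le_sqrt hτC) (Real.sqrt_nonneg _))
      _ ≤ Sint := setIntegral_mono_set hnsT
          (Eventually.of_forall fun τ => by positivity) hsub.eventuallyLE
  -- combine
  have hXN0 : 0 ≤ ∫ τ in Ioc 0 t, 4 * Real.pi ^ 2 * ∑ k ∈ freqBall N,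
      Torus.diagSymbol a k * ‖mFourierCoeff (fun x => (θ τ x : ℂ)) k‖ ^ 2 :=
    setIntegral_nonneg measurableSet_Ioc fun τ _ => mul_nonneg (by positivity)
      (Finset.sum_nonneg fun k _ => mul_nonneg (Torus.diagSymbol_nonneg (fun i => (ha i).le) k) (sq_nonneg _))
  have hc0 : 0 ≤ Cu ^ 2 / (κ * m) := by positivity
  have key : κ * (∫ τ in Ioc 0 t, 4 * Real.pi ^ 2 * ∑ k ∈ freqBall N,
      Torus.diagSymbol a k * ‖mFourierCoeff (fun x => (θ τ x : ℂ)) k‖ ^ 2) ≤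
      (∫ x, θ₀ x ^ 2) + Cu ^ 2 / (κ * m) * Eint + 2 * Sint := by
    have e1 := abs_le.1 hb3
    have e2 := abs_le.1 hb4
    nlinarith [e1.1, e1.2, e2.1, e2.2, hb1, hb2, hb3', hc0, ht]
  rw [hK, le_div_iff₀ hκ]
  linarith

/-! ## Monotone convergence: the `A`-dissipation as the limit of the truncated dissipations -/

/-- **The time-integrated `A`-dissipation is the monotone limit of the truncated ones**: for
`t ≤ T` and nonnegative coefficients,
`∫⁻_{(0,t)} ‖∇θ(τ)‖²_a dτ = ⨆_N ofReal (∫_{(0,t)} 4π² ∑_{|k|≤N} Q_a(k)|θ̂(τ)(k)|² dτ)`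
(Beppo Levi; the ball partial sums increase to `Torus.eScalarGradNormSqDiag`).
[cite: Grafakos2014, Prop. 3.2.7 (3)] -/
theorem lintegral_eScalarGradNormSqDiag_eq_iSup (h : IsWeakScalarTransportDiagForcedOn T a κ u s θ₀ θ)
    (ha : ∀ i, 0 ≤ a i) {t : ℝ} (ht : t ≤ T) :
    ∫⁻ τ in Ioo 0 t, Torus.eScalarGradNormSqDiag a (θ τ) =
      ⨆ N : ℕ, ENNReal.ofReal (∫ τ in Ioo 0 t, 4 * Real.pi ^ 2 * ∑ k ∈ freqBall N,
        Torus.diagSymbol a k * ‖mFourierCoeff (fun x => (θ τ x : ℂ)) k‖ ^ 2) := by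
  have hsub : Ioo 0 t ⊆ Ioo 0 T := Ioo_subset_Ioo_right ht
  have hF : ∀ (N : ℕ) (τ : ℝ), ∑ k ∈ freqBall N, ENNReal.ofReal (4 * Real.pi ^ 2) *
      (ENNReal.ofReal (Torus.diagSymbol a k) * ‖mFourierCoeff (fun x => (θ τ x : ℂ)) k‖ₑ ^ 2) =
      ENNReal.ofReal (4 * Real.pi ^ 2 * ∑ k ∈ freqBall N,
        Torus.diagSymbol a k * ‖mFourierCoeff (fun x => (θ τ x : ℂ)) k‖ ^ 2) :=
    fun N τ => Torus.sum_freqBall_diag_eq_ofReal ha (θ τ) N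
  have hmeas : ∀ N : ℕ, AEMeasurable (fun τ => ∑ k ∈ freqBall N, ENNReal.ofReal (4 * Real.pi ^ 2) *
      (ENNReal.ofReal (Torus.diagSymbol a k) * ‖mFourierCoeff (fun x => (θ τ x : ℂ)) k‖ₑ ^ 2))
      (volume.restrict (Ioo 0 t)) := by
    intro N
    rw [show (fun τ => ∑ k ∈ freqBall N, ENNReal.ofReal (4 * Real.pi ^ 2) *
      (ENNReal.ofReal (Torus.diagSymbol a k) * ‖mFourierCoeff (fun x => (θ τ x : ℂ)) k‖ₑ ^ 2)) =
      fun τ => ENNReal.ofReal (4 * Real.pi ^ 2 * ∑ k ∈ freqBall N,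
        Torus.diagSymbol a k * ‖mFourierCoeff (fun x => (θ τ x : ℂ)) k‖ ^ 2) from funext (hF N)]
    exact ((h.integrableOn_galerkin_diss N).mono_set hsub).aestronglyMeasurable.aemeasurable.ennreal_ofReal
  calc ∫⁻ τ in Ioo 0 t, Torus.eScalarGradNormSqDiag a (θ τ)
      = ∫⁻ τ in Ioo 0 t, ⨆ N : ℕ, ∑ k ∈ freqBall N, ENNReal.ofReal (4 * Real.pi ^ 2) *
          (ENNReal.ofReal (Torus.diagSymbol a k) * ‖mFourierCoeff (fun x => (θ τ x : ℂ)) k‖ₑ ^ 2) :=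
        lintegral_congr fun τ => (Torus.iSup_sum_freqBall_diag a (θ τ)).symm
    _ = ⨆ N : ℕ, ∫⁻ τ in Ioo 0 t, ∑ k ∈ freqBall N, ENNReal.ofReal (4 * Real.pi ^ 2) *
          (ENNReal.ofReal (Torus.diagSymbol a k) * ‖mFourierCoeff (fun x => (θ τ x : ℂ)) k‖ₑ ^ 2) :=
        lintegral_iSup' hmeas (ae_of_all _ fun τ => Torus.monotone_sum_freqBall_diag a (θ τ))
    _ = _ := by
        refine iSup_congr fun N => ?_
        rw [lintegral_congr fun τ => hF N τ, ← ofReal_integral_eq_lintegral_ofReal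
          ((h.integrableOn_galerkin_diss N).mono_set hsub) (ae_of_all _ fun τ => ?_)]
        exact mul_nonneg (by positivity) (Finset.sum_nonneg fun k _ =>
          mul_nonneg (Torus.diagSymbol_nonneg ha k) (sq_nonneg _))

/-- **Parabolic regularity, `L²_t H¹_x` with the `A`-norm**: for `κ > 0`, positive coefficients,
`θ₀ ∈ L²`, an `L^∞` drift and a source in `L¹_t L²_x`, every weak solution of the diagonal class
satisfies `∫⁻_{(0,T)} ‖∇θ(τ)‖²_a dτ ≤ ofReal K < ∞` with the constant of the first pass
(Bonicatto–Ciampa–Crippa 2024, Thm. 3.3: distributional solutions in `L^∞_t L²_x` with bounded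
divergence-free drift are parabolic). [cite: BonicattoCiampaCrippa2023, Thm. 3.3] -/
theorem lintegral_eScalarGradNormSqDiag_lt_top (h : IsWeakScalarTransportDiagForcedOn T a κ u s θ₀ θ)
    (hκ : 0 < κ) (ha : ∀ i, 0 < a i) (hθ₀ : MemLp θ₀ 2 volume)
    (hu : MemLp (stLift u) ⊤ (volume.restrict (Ioo 0 T ×ˢ univ)))
    (hs : ∫⁻ t in Ioo 0 T, (∫⁻ x, ‖s t x‖ₑ ^ 2) ^ (1 / 2 : ℝ) < ⊤) :
    ∫⁻ τ in Ioo 0 T, Torus.eScalarGradNormSqDiag a (θ τ) < ⊤ := by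
  obtain ⟨K, hK0, hK⟩ := h.exists_integral_galerkin_diss_le hκ ha hθ₀ hu hs
  rw [h.lintegral_eScalarGradNormSqDiag_eq_iSup (fun i => (ha i).le) le_rfl]
  exact (iSup_le fun N => ENNReal.ofReal_le_ofReal (hK N)).trans_lt ENNReal.ofReal_lt_top

/-! ## Second pass: the transport remainder vanishes in the limit -/

/-- **The integrated transport remainder tends to zero**: for `t ∈ (0,T)`,
`∫_{(0,t]} ∫ (θ - P_N θ)⟪u, ∇P_N θ⟫ → 0` as `N → ∞` (Cauchy–Schwarz in space and time: the bound
`(C_u/√m) √(∫∫(θ - P_Nθ)²) √K` with the uniform dissipation bound `K` of the first pass and the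
vanishing Parseval tails). [cite: BonicattoCiampaCrippa2023, Thm. 3.3 (proof: the commutator term vanishes)] -/
theorem tendsto_integral_galerkin_remainder (h : IsWeakScalarTransportDiagForcedOn T a κ u s θ₀ θ)
    (hκ : 0 < κ) (ha : ∀ i, 0 < a i) (hθ₀ : MemLp θ₀ 2 volume)
    (hu : MemLp (stLift u) ⊤ (volume.restrict (Ioo 0 T ×ˢ univ)))
    (hs : ∫⁻ t in Ioo 0 T, (∫⁻ x, ‖s t x‖ₑ ^ 2) ^ (1 / 2 : ℝ) < ⊤) {t : ℝ} (ht : t < T) :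
    Tendsto (fun N => ∫ τ in Ioc 0 t, ∫ x, (θ τ x - scalarTruncate N (θ τ) x) *
      ⟪u τ x, gradient (scalarTruncate N (θ τ)) x⟫_ℝ) atTop (𝓝 0) := by
  obtain ⟨m, hm, hma⟩ := exists_pos_forall_le_of_forall_pos ha
  obtain ⟨Cu, hCu0, hR⟩ := h.exists_ae_abs_galerkin_remainder_le hu
  obtain ⟨K, hK0, hK⟩ := h.exists_integral_galerkin_diss_le hκ ha hθ₀ hu hs
  have hsub : Ioc 0 t ⊆ Ioo 0 T := Ioc_subset_Ioo_right ht
  have hsm : 0 < Real.sqrt m := Real.sqrt_pos.2 hm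
  -- the tails
  set ε : ℕ → ℝ := fun N => ∫ τ in Ioo 0 T, ∫ x, (θ τ x - scalarTruncate N (θ τ) x) ^ 2 with hε
  have hε0 : Tendsto ε atTop (𝓝 0) := h.tendsto_integral_galerkin_tail
  have hεnn : ∀ N, 0 ≤ ε N := fun N => setIntegral_nonneg measurableSet_Ioo fun τ _ =>
    integral_nonneg fun x => sq_nonneg _
  -- the bound `b N = (Cu/√m) √(ε N) √K → 0`
  have hb : Tendsto (fun N => Cu / Real.sqrt m * (Real.sqrt (ε N) * Real.sqrt K)) atTop (𝓝 0) := by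
    have h1 := ((Real.continuous_sqrt.tendsto 0).comp hε0).mul_const (Real.sqrt K)
    rw [Real.sqrt_zero, zero_mul] at h1
    simpa using h1.const_mul (Cu / Real.sqrt m)
  refine squeeze_zero_norm (fun N => ?_) hb
  -- pointwise: `‖R‖ ≤ (Cu/√m) √e2 √D`
  have hDnn : ∀ (N : ℕ) (τ : ℝ), 0 ≤ 4 * Real.pi ^ 2 * ∑ k ∈ freqBall N,
      Torus.diagSymbol a k * ‖mFourierCoeff (fun x => (θ τ x : ℂ)) k‖ ^ 2 := fun N τ =>
    mul_nonneg (by positivity) (Finset.sum_nonneg fun k _ =>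
      mul_nonneg (Torus.diagSymbol_nonneg (fun i => (ha i).le) k) (sq_nonneg _))
  have henn : ∀ (N : ℕ) (τ : ℝ), 0 ≤ ∫ x, (θ τ x - scalarTruncate N (θ τ) x) ^ 2 := fun N τ =>
    integral_nonneg fun x => sq_nonneg _
  have hei := (h.integrableOn_galerkin_tail N).mono_set hsub
  have hDi := (h.integrableOn_galerkin_diss N).mono_set hsub
  have hgi : IntegrableOn (fun τ => Cu / Real.sqrt m *
      (Real.sqrt (∫ x, (θ τ x - scalarTruncate N (θ τ) x) ^ 2) *
        Real.sqrt (4 * Real.pi ^ 2 * ∑ k ∈ freqBall N,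
          Torus.diagSymbol a k * ‖mFourierCoeff (fun x => (θ τ x : ℂ)) k‖ ^ 2))) (Ioc 0 t) volume := by
    refine Integrable.const_mul (Integrable.mono' ((hei.add hDi).div_const 2)
      ((Real.continuous_sqrt.comp_aestronglyMeasurable hei.aestronglyMeasurable).mul
        (Real.continuous_sqrt.comp_aestronglyMeasurable hDi.aestronglyMeasurable))
      (Eventually.of_forall fun τ => ?_)) _
    simp only [Pi.add_apply, Pi.mul_apply, Real.norm_eq_abs]
    rw [abs_of_nonneg (mul_nonneg (Real.sqrt_nonneg _) (Real.sqrt_nonneg _))]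
    nlinarith [Real.sq_sqrt (henn N τ), Real.sq_sqrt (hDnn N τ),
      sq_nonneg (Real.sqrt (∫ x, (θ τ x - scalarTruncate N (θ τ) x) ^ 2) -
        Real.sqrt (4 * Real.pi ^ 2 * ∑ k ∈ freqBall N,
          Torus.diagSymbol a k * ‖mFourierCoeff (fun x => (θ τ x : ℂ)) k‖ ^ 2))]
  calc ‖∫ τ in Ioc 0 t, ∫ x, (θ τ x - scalarTruncate N (θ τ) x) *
          ⟪u τ x, gradient (scalarTruncate N (θ τ)) x⟫_ℝ‖
      ≤ ∫ τ in Ioc 0 t, Cu / Real.sqrt m *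
          (Real.sqrt (∫ x, (θ τ x - scalarTruncate N (θ τ) x) ^ 2) *
            Real.sqrt (4 * Real.pi ^ 2 * ∑ k ∈ freqBall N,
              Torus.diagSymbol a k * ‖mFourierCoeff (fun x => (θ τ x : ℂ)) k‖ ^ 2)) := by
        refine norm_integral_le_of_norm_le hgi (ae_restrict_of_ae_restrict_of_subset hsub ?_)
        filter_upwards [hR N] with τ hτ
        rw [Real.norm_eq_abs]
        refine hτ.trans ?_
        have hG : Real.sqrt (∫ x, ‖gradient (scalarTruncate N (θ τ)) x‖ ^ 2) ≤
            Real.sqrt (4 * Real.pi ^ 2 * ∑ k ∈ freqBall N,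
              Torus.diagSymbol a k * ‖mFourierCoeff (fun x => (θ τ x : ℂ)) k‖ ^ 2) / Real.sqrt m := by
          rw [le_div_iff₀ hsm, ← Real.sqrt_mul (integral_nonneg fun x => sq_nonneg _)]
          refine Real.sqrt_le_sqrt ?_
          rw [mul_comm]
          exact mul_integral_norm_sq_gradient_scalarTruncate_le hma N (θ τ)
        calc Cu * (Real.sqrt (∫ x, (θ τ x - scalarTruncate N (θ τ) x) ^ 2) *
              Real.sqrt (∫ x, ‖gradient (scalarTruncate N (θ τ)) x‖ ^ 2))
            ≤ Cu * (Real.sqrt (∫ x, (θ τ x - scalarTruncate N (θ τ) x) ^ 2) *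
              (Real.sqrt (4 * Real.pi ^ 2 * ∑ k ∈ freqBall N,
                Torus.diagSymbol a k * ‖mFourierCoeff (fun x => (θ τ x : ℂ)) k‖ ^ 2) / Real.sqrt m)) := by
              gcongr
          _ = _ := by
              field_simp
    _ = Cu / Real.sqrt m * ∫ τ in Ioc 0 t, Real.sqrt (∫ x, (θ τ x - scalarTruncate N (θ τ) x) ^ 2) *
          Real.sqrt (4 * Real.pi ^ 2 * ∑ k ∈ freqBall N,
            Torus.diagSymbol a k * ‖mFourierCoeff (fun x => (θ τ x : ℂ)) k‖ ^ 2) := integral_const_mul _ _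
    _ ≤ Cu / Real.sqrt m * (Real.sqrt (∫ τ in Ioc 0 t, ∫ x, (θ τ x - scalarTruncate N (θ τ) x) ^ 2) *
          Real.sqrt (∫ τ in Ioc 0 t, 4 * Real.pi ^ 2 * ∑ k ∈ freqBall N,
            Torus.diagSymbol a k * ‖mFourierCoeff (fun x => (θ τ x : ℂ)) k‖ ^ 2)) :=
        mul_le_mul_of_nonneg_left (integral_sqrt_mul_sqrt_le_of_nonneg hei hDi (ae_of_all _ (henn N))
          (ae_of_all _ (hDnn N))) (by positivity)
    _ ≤ Cu / Real.sqrt m * (Real.sqrt (ε N) * Real.sqrt K) := by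
        gcongr
        · exact setIntegral_mono_set (h.integrableOn_galerkin_tail N) (ae_of_all _ (henn N))
            hsub.eventuallyLE
        · exact (setIntegral_mono_set (h.integrableOn_galerkin_diss N) (ae_of_all _ (hDnn N))
            hsub.eventuallyLE).trans (hK N)

end IsWeakScalarTransportDiagForcedOn

end Torus

end Literature.Analysis.FluidPDE

end
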